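import Literature.Probability.LatticeModels.CoarseCellMixingDefectsBlockLeak
import Literature.Probability.LatticeModels.CoarseCellMixingPeierls
import Literature.MathematicalPhysics.QuantumFieldTheory.QuasiLocalGaugePerturbationBlockLeak

/-!
# Line `local-ac-open-certificate`, crux `RobustYangMills` (stmt-QuantumFields-13897) —
# typed variants of the open engine stub `stub_annealedEngineBQL` (lead c3, for the planner)

Companion to `Lines/local-ac-open-certificate-c3-engine.md` (promotion dossier). The registered stub is
`stub_annealedEngineBQL : AnnealedEngineBQL` (tree `Theorems/NestedDissectionSeaRobustYangMillsEngineBQL.lean`):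
the annealed boundary-influence bound for ONE quasi-local specification (`HasBlockLeak cell γ a r`, `a ≤ a₀`)
with the good-exterior finite-size condition and the kernel-uniform Peierls bound; its `a = 0` slice is the
proved Literature theorem `annealed_influence_markov_defects`. This file types the two fileable variants of
the `0 < a ≤ a₀` slice named in the dossier, WITHOUT importing the (currently farm-unbuilt) EngineBQL module:

* `AnnealedEngineBQLBorel` — Variant A: the registered statement verbatim with `[StandardBorelSpace S]`
  added (what a coupling / maximal-coupling-kernel proof needs; harmless for the line, `S = SU(3)`);
* `DressedGaugeEngine d` — Variant B (polymer currency, Literature vocabulary only): reference = Wilson's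
  block-Markov kernels `(0 : QuasiLocalGaugePerturbation d N G 1).kernel ρ β` carrying the certificate data
  (`IsGoodFS`, `UniformKernelPeierls`), dressing = a perturbation `W` with `‖W‖_{b,κ} ≤ η`, `η·K ≤ η₀(n)`,
  `κ ≥ κ₀(n)` and range control (h4); conclusion = covariance decay `C₀ B_f B_g e^{|Δf|} |Δg| e^{-κₑ D}`
  under `W.perturbedMeasure ρ β`. This is exactly what the deployment consumes (the perturbed kernels ARE
  `W.kernel ρ β`), it contains no abstract `HasBlockLeak` interface, and it is the form in which the
  literature architecture (Bertini–Cirillo–Olivieri graded cluster expansion, CMP 258 (2005); Olivieri–Picco,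
  JSP 59 (1990)) would prove it: the (h3) norm is a Kotecký–Preiss criterion with room `e^{κ|X|}`.

Both are statements only (no `sorry`, no proof claimed); the `W = 0` slice of Variant B is, up to the
deployment's threading, the landed `…WilsonSlice.lean` (p123973).
-/

set_option autoImplicit false

noncomputable section

namespace Summit.QuantumFields.QCD.Cruxes.RobustYangMills.LocalAcOpenCertificate.EngineVariants

open MeasureTheory
open Literature.MathematicalPhysics.QuantumLattice Literature.MathematicalPhysics.QuantumFieldTheory
open Literature.Probability.LatticeModels (CoarseIdx cdist shellCount cellCount IsGoodFS HasBlockLeak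
  UniformKernelPeierls Specification IsSpecification IsGibbsMeasure)

/-- **Variant A** of the open engine stub: `AnnealedEngineBQL` verbatim with a standard Borel single-spin
space (`[StandardBorelSpace S]`), the hypothesis a disagreement-percolation / block-coupling proof needs for
measurable maximal couplings of the kernels. For every window `n ≥ 1` and leak rate `r > 0` there are
`q₀, a₀, κₑ > 0`, `C ≥ 0` such that ONE specification on a coarse 4-torus (`≥ 4n+3` cells per axis) with the
good-exterior finite-size condition `(n, ε)`, `ε·shellCount 4 n ≤ 3/4`, block quasi-locality
`HasBlockLeak cell γ a r`, `a ≤ a₀`, and the kernel-uniform Peierls bound at level `q ≤ q₀` has, for every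
Gibbs measure `ν`, `∫ |γ_Λ f − ν f| dν ≤ C e^{|Δf|} |Δg| e^{−κₑ D}`. -/
def AnnealedEngineBQLBorel : Prop :=
  ∀ n : ℕ, 1 ≤ n → ∀ r : ℝ, 0 < r → ∃ q₀ a₀ κₑ C : ℝ, 0 < q₀ ∧ 0 < a₀ ∧ 0 < κₑ ∧ 0 ≤ C ∧
    ∀ (μc : Fin 4 → ℕ) (V S : Type) [Fintype V] [MeasurableSpace S] [StandardBorelSpace S]
      (cell : V → CoarseIdx μc) (γ : Specification V S) (good : CoarseIdx μc → Set (V → S))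
      (ν : Measure (V → S)) (ε q a : ℝ),
      (∀ i, 4 * n + 3 ≤ μc i + 1) → IsSpecification γ → IsGibbsMeasure γ ν →
      0 ≤ ε → ε * (shellCount 4 n : ℝ) ≤ 3 / 4 → IsGoodFS cell γ good n ε →
      0 ≤ a → a ≤ a₀ → HasBlockLeak cell γ a r →
      0 ≤ q → q ≤ q₀ → UniformKernelPeierls cell γ good q →
      ∀ (f : (V → S) → ℝ) (Δf Δg : Finset (CoarseIdx μc)) (D : ℕ),
        Measurable f → (∀ σ, 0 ≤ f σ ∧ f σ ≤ 1) → DependsOn f {v | cell v ∈ Δf} →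
        (∀ x ∈ Δf, ∀ y ∈ Δg, D ≤ cdist x y) →
          ∫ ζ, |∫ σ, f σ ∂(γ (Finset.univ.filter fun v => cell v ∉ Δg) ζ) - ∫ σ, f σ ∂ν| ∂ν ≤
            C * Real.exp (Δf.card) * Δg.card * Real.exp (-(κₑ * D))

/-- **Variant B** of the open engine stub, in polymer currency (`d`-dimensional tori, any compact gauge
group, any finite-dimensional continuous representation): for every window `n ≥ 1` there are thresholds
`p₀, η₀, κ₀ > 0` and, for every finite-size threshold `ε` with `ε·shellCount d n ≤ 3/4`, a rate `κₑ > 0`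
and a constant `C₀ ≥ 0` such that: whenever the cells (`≥ 4n+3` per axis) meet at most `K` blocks per cell
and contract block nearness, Wilson's kernels at coupling `β` satisfy the good-exterior finite-size
condition `(n, ε)` and the kernel-uniform Peierls bound at level `p ≤ p₀` for some cell-local good sets,
and the dressing `W` (block scale `b ≥ 1`) has `‖W‖_{b,κ} ≤ η` with `κ ≥ κ₀`, `η·K ≤ η₀` and range
control (h4), then the perturbed measure `μ_{β,W}` has covariance decay
`|⟨fg⟩ − ⟨f⟩⟨g⟩| ≤ C₀ B_f B_g e^{|Δf|} |Δg| e^{−κₑ D}` for cell-local bounded `f, g` at coarse distance `≥ D`.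
(The statement the deployment consumes; OPEN for `W ≠ 0`; its `W = 0` slice follows from the proved
block-Markov engine.) -/
def DressedGaugeEngine (d : ℕ) : Prop :=
  ∀ n : ℕ, 1 ≤ n → ∃ p₀ η₀ κ₀ : ℝ, 0 < p₀ ∧ 0 < η₀ ∧ 0 < κ₀ ∧
    ∀ ε : ℝ, 0 ≤ ε → ε * (shellCount d n : ℝ) ≤ 3 / 4 →
    ∃ κₑ C₀ : ℝ, 0 < κₑ ∧ 0 ≤ C₀ ∧
    ∀ (G : Type) [Group G] [TopologicalSpace G] [IsTopologicalGroup G] [CompactSpace G]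
      [MeasurableSpace G] [BorelSpace G] [SecondCountableTopology G] [MeasurableSingletonClass G]
      (Nρ : ℕ) (ρ : G →* Matrix (Fin Nρ) (Fin Nρ) ℂ), Continuous ρ →
    ∀ (N : ℕ) [NeZero N] (b : ℕ) (μc : Fin d → ℕ) (cell : Edge d N → CoarseIdx μc) (K : ℝ)
      (good : CoarseIdx μc → Set (GaugeConfig d N G)) (β κ η p : ℝ)
      (W : QuasiLocalGaugePerturbation d N G b),
      1 ≤ b → (∀ i, 4 * n + 3 ≤ μc i + 1) → 0 ≤ K →
      (∀ A : Finset (Edge d N),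
        ((A.image fun e => blockCorner b e.1).card : ℝ) ≤ K * cellCount cell A) →
      (∀ (D : ℕ) (e e' : Edge d N),
        (∀ i, (blockCorner b e'.1 i - blockCorner b e.1 i).val ≤ b * (2 * D + 1) ∨
          (blockCorner b e.1 i - blockCorner b e'.1 i).val ≤ b * (2 * D + 1)) →
        cdist (cell e') (cell e) ≤ D + 1) →
      IsGoodFS cell ((0 : QuasiLocalGaugePerturbation d N G 1).kernel ρ β) good n ε →
      0 ≤ p → p ≤ p₀ →
      UniformKernelPeierls cell ((0 : QuasiLocalGaugePerturbation d N G 1).kernel ρ β) good p →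
      κ₀ ≤ κ → W.NormLE κ η → η * K ≤ η₀ →
      (∀ X : Finset (Site d N), X ∈ polymers b → (∃ U : GaugeConfig d N G, W.act X U ≠ 0) →
        ∀ y ∈ X, ∀ y' ∈ X, ∀ i : Fin d,
          (y i - y' i).val ≤ b * X.card ∨ (y' i - y i).val ≤ b * X.card) →
      ∀ (f g : GaugeConfig d N G → ℝ) (Δf Δg : Finset (CoarseIdx μc)) (Bf Bg : ℝ) (D : ℕ),
        Measurable f → Measurable g → (∀ U, |f U| ≤ Bf) → (∀ U, |g U| ≤ Bg) →
        DependsOn f {e | cell e ∈ Δf} → DependsOn g {e | cell e ∈ Δg} →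
        (∀ x ∈ Δf, ∀ y ∈ Δg, D ≤ cdist x y) →
          |∫ U, f U * g U ∂(W.perturbedMeasure ρ β) -
              (∫ U, f U ∂(W.perturbedMeasure ρ β)) * ∫ U, g U ∂(W.perturbedMeasure ρ β)| ≤
            C₀ * Bf * Bg * Real.exp (Δf.card) * Δg.card * Real.exp (-(κₑ * D))

end Summit.QuantumFields.QCD.Cruxes.RobustYangMills.LocalAcOpenCertificate.EngineVariants

end
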